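import Mathlib
import HarnessLib
import Summits.HubbardSuperconductivity.HubbardSuperconductivity.Theorems.KLProgrammeC4aBubbleTubeDeriv
import Summits.HubbardSuperconductivity.HubbardSuperconductivity.Theorems.KLProgrammeC4aLevelDensityRadial

/-!
# Route `KLProgramme` — crux C4a, S3 brick (B4) «(U1)-HYBRID» B-1 (viii): THE ROTATED JACOBIAN FAMILY `J(e, v) = levelChartJac μ K (e, v + θ)` MEETS THE JACOBIAN ROWS of
# `firstOrderLayer_abs_le` and of U7's numerator (`…C4aUmkNumerator`): `C¹`, `|J| ≤ klJacG₀`, `|∂_vJ| ≤ klJacG₁`, `2π`-periodic, jointly continuous, `e`-Lipschitz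

Cell `gate-hubbard-kl`, seat hubbard-kl-k3c3-p3 (g37; row «implicit-function / monotonicity route for μ(n)»).  Located brick for the (C)-closer lane / the `M₁`
assembly (stub (C) `stub_twoLeg_curvature` of `KLRegimeEngineV17F2`, stmt-HubbardSuperconductivity-20437), memo HOME/hubbard-kl-k3c3-p3/U1-CAUSTIC-SUP.md §19–§20 (B-1).

WHY.  `…C4aFirstOrderLevelLine.norm_deriv_loopIntegral_pp_eq_abs` identifies the first-order co-moving jet of a level line with the level line of
`…C4aFirstOrderLayerSum.firstOrderLayer_abs_le` for the Jacobian family `Jw e v := levelChartJac μ K (e, v + θ)` (base angle `θ` fixed).  This file discharges every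
Jacobian row of that theorem and of U7's numerator rows for this family, from `…C4aJacobianFrameJets` (`abs_levelChartJac_le'`, `abs_deriv_levelChartJac_le`),
`…C4aTubeTadpole` (`contDiffOn_levelChartJac`, `levelChartJac_periodic`) and `…C4aLevelDensityRadial.abs_levelChartJac_sub_le`:
* `contDiff_jacFamily`, `abs_jacFamily_le`, `abs_deriv_jacFamily_le`, `jacFamily_periodic`, `continuousOn_jacFamily₂`, `abs_jacFamily_sub_le` (`e`-Lipschitz,
  constant `1/(Dt−2A)² + π√2(2+4A)/(Dt−2A)³`).
Sizes binder shape; pure bookkeeping on landed objects; nothing asserts (C), K3 or superconductivity.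
References: FST II CPAM 51 (1998) §3 [cite: FeldmanSalmhoferTrubowitz1998]; BGM 2006 §2.4 [cite: BenfattoGiulianiMastropietro2006].
-/

noncomputable section

namespace Summit.HubbardSuperconductivity.HubbardSuperconductivity.Theorems.C4a

set_option linter.dupNamespace false -- summit = problem name (single-conjunct summit), D-0017

open Real Set Filter
open scoped Topology ContDiff
open Literature.MathematicalPhysics.QuantumLattice Literature.MathematicalPhysics.QuantumLattice.BandSectorCounting Literature.Probability.LatticeModels
open Summit.HubbardSuperconductivity.HubbardSuperconductivity.Theorems.KLRegimeSplit
open Summit.HubbardSuperconductivity.HubbardSuperconductivity.Theorems.DispersionFlow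
open Summit.HubbardSuperconductivity.HubbardSuperconductivity.Theorems.PerturbedFermiCurve

section Sizes

variable {K : TrigPolyC4v} {A : ℝ} (hA : ∀ p : Momentum, ∀ j ≤ 2, ‖iteratedFDeriv ℝ j (frameShift K) p‖ ≤ A)
  (hd : klCurveD ≤ (bandBounds (show (-4 : ℝ) < -1.1 by norm_num) (show (-1.1 : ℝ) ≤ -0.1 by norm_num)
    (show (-0.1 : ℝ) < 0 by norm_num)).Dtmin - 2 * A)
  {μ r : ℝ} (hlo : (-1.1 : ℝ) < μ - r - A) (hhi : μ + r + A < -0.1)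
include hA hd hlo hhi

/-- `v ↦ J(e, v + θ)` is `C¹` for `|e| ≤ hi < r`. -/
theorem contDiff_jacFamily {hi : ℝ} (hhir : hi < r) (θ : ℝ) {e : ℝ} (he : e ∈ Icc (-hi) hi) :
    ContDiff ℝ 1 (fun v : ℝ => levelChartJac μ K (e, v + θ)) := by
  set B₀ := bandBounds (show (-4 : ℝ) < -1.1 by norm_num) (show (-1.1 : ℝ) ≤ -0.1 by norm_num) (show (-0.1 : ℝ) < 0 by norm_num) with hB₀
  have hADt : 2 * A < B₀.Dtmin := by have := klCurveD_pos; linarith only [this, hd]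
  have her : |e| < r := lt_of_le_of_lt (abs_le.2 ⟨he.1, he.2⟩) hhir
  exact ((contDiff_levelChartJac_angle B₀ hA hADt hlo hhi her).of_le (by simp)).comp (contDiff_id.add contDiff_const)

/-- `|J(e, v+θ)| ≤ klJacG₀ = π√2/(Dt−2A)`. -/
theorem abs_jacFamily_le {hi : ℝ} (hhir : hi < r) (θ A₃ : ℝ) {e : ℝ} (he : e ∈ Icc (-hi) hi) (v : ℝ) :
    |levelChartJac μ K (e, v + θ)| ≤
      klJacG ((bandBounds (show (-4 : ℝ) < -1.1 by norm_num) (show (-1.1 : ℝ) ≤ -0.1 by norm_num) (show (-0.1 : ℝ) < 0 by norm_num)).Dtmin) A A₃ 0 := by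
  set B₀ := bandBounds (show (-4 : ℝ) < -1.1 by norm_num) (show (-1.1 : ℝ) ≤ -0.1 by norm_num) (show (-0.1 : ℝ) < 0 by norm_num) with hB₀
  have hADt : 2 * A < B₀.Dtmin := by have := klCurveD_pos; linarith only [this, hd]
  have her : |e| < r := lt_of_le_of_lt (abs_le.2 ⟨he.1, he.2⟩) hhir
  have he1 := (abs_lt.1 her).1
  have he2 := (abs_lt.1 her).2
  exact abs_levelChartJac_le' B₀ hA hADt (μ := μ) (ρ := e) (by linarith) (by linarith) A₃ (v + θ)

/-- `|∂_v J(e, v+θ)| ≤ klJacG₁`. -/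
theorem abs_deriv_jacFamily_le {hi : ℝ} (hhir : hi < r) (θ A₃ : ℝ) {e : ℝ} (he : e ∈ Icc (-hi) hi) (v : ℝ) :
    |deriv (fun v : ℝ => levelChartJac μ K (e, v + θ)) v| ≤
      klJacG ((bandBounds (show (-4 : ℝ) < -1.1 by norm_num) (show (-1.1 : ℝ) ≤ -0.1 by norm_num) (show (-0.1 : ℝ) < 0 by norm_num)).Dtmin) A A₃ 1 := by
  set B₀ := bandBounds (show (-4 : ℝ) < -1.1 by norm_num) (show (-1.1 : ℝ) ≤ -0.1 by norm_num) (show (-0.1 : ℝ) < 0 by norm_num) with hB₀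
  have hADt : 2 * A < B₀.Dtmin := by have := klCurveD_pos; linarith only [this, hd]
  have her : |e| < r := lt_of_le_of_lt (abs_le.2 ⟨he.1, he.2⟩) hhir
  have he1 := (abs_lt.1 her).1
  have he2 := (abs_lt.1 her).2
  rw [deriv_comp_add_const (fun s : ℝ => levelChartJac μ K (e, s)) θ v]
  exact abs_deriv_levelChartJac_le B₀ hA hADt (μ := μ) (ρ := e) (by linarith) (by linarith) A₃ (v + θ)

omit hA hd hlo hhi in
/-- `J(e, ·+θ)` is `2π`-periodic. -/
theorem jacFamily_periodic (μ : ℝ) (K : TrigPolyC4v) (θ e v : ℝ) : levelChartJac μ K (e, v + 2 * π + θ) = levelChartJac μ K (e, v + θ) := by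
  rw [show v + 2 * π + θ = (v + θ) + 2 * π by ring]
  exact levelChartJac_periodic μ K e (v + θ)

/-- `(e, v) ↦ J(e, v + θ)` is continuous on `[−hi, hi] × ℝ` (`hi < r`). -/
theorem continuousOn_jacFamily₂ {hi : ℝ} (hhir : hi < r) (θ : ℝ) :
    ContinuousOn (fun q : ℝ × ℝ => levelChartJac μ K (q.1, q.2 + θ)) (Icc (-hi) hi ×ˢ univ) := by
  set B₀ := bandBounds (show (-4 : ℝ) < -1.1 by norm_num) (show (-1.1 : ℝ) ≤ -0.1 by norm_num) (show (-0.1 : ℝ) < 0 by norm_num) with hB₀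
  have hADt : 2 * A < B₀.Dtmin := by have := klCurveD_pos; linarith only [this, hd]
  have hJ := (contDiffOn_levelChartJac B₀ hA hADt hlo hhi (μ := μ)).continuousOn
  have hf : Continuous fun q : ℝ × ℝ => ((q.1, q.2 + θ) : ℝ × ℝ) := continuous_fst.prodMk (continuous_snd.add continuous_const)
  refine (hJ.comp hf.continuousOn fun q hq => ?_).congr fun q _ => rfl
  have he : q.1 ∈ Icc (-hi) hi := (mem_prod.1 hq).1
  exact mem_prod.2 ⟨lt_of_le_of_lt (abs_le.2 ⟨he.1, he.2⟩) hhir, mem_univ _⟩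

/-- **`e`-Lipschitz row**: `|J(e, v+θ) − J(e′, v+θ)| ≤ (1/(Dt−2A)² + π√2(2+4A)/(Dt−2A)³)·|e − e′|` for `|e|, |e′| ≤ hi < r`. -/
theorem abs_jacFamily_sub_le {hi : ℝ} (hhir : hi < r) (θ : ℝ) {e e' : ℝ} (he : e ∈ Icc (-hi) hi) (he' : e' ∈ Icc (-hi) hi) (v : ℝ) :
    |levelChartJac μ K (e, v + θ) - levelChartJac μ K (e', v + θ)| ≤
      (1 / ((bandBounds (show (-4 : ℝ) < -1.1 by norm_num) (show (-1.1 : ℝ) ≤ -0.1 by norm_num) (show (-0.1 : ℝ) < 0 by norm_num)).Dtmin - 2 * A) ^ 2 +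
        Real.pi * Real.sqrt 2 * (2 + 4 * A) /
          ((bandBounds (show (-4 : ℝ) < -1.1 by norm_num) (show (-1.1 : ℝ) ≤ -0.1 by norm_num) (show (-0.1 : ℝ) < 0 by norm_num)).Dtmin - 2 * A) ^ 3) * |e - e'| := by
  set B₀ := bandBounds (show (-4 : ℝ) < -1.1 by norm_num) (show (-1.1 : ℝ) ≤ -0.1 by norm_num) (show (-0.1 : ℝ) < 0 by norm_num) with hB₀
  have hADt : 2 * A < B₀.Dtmin := by have := klCurveD_pos; linarith only [this, hd]
  have heI : e ∈ Ioo (-r) r := ⟨by linarith [he.1], lt_of_le_of_lt he.2 hhir⟩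
  have he'I : e' ∈ Ioo (-r) r := ⟨by linarith [he'.1], lt_of_le_of_lt he'.2 hhir⟩
  exact abs_levelChartJac_sub_le B₀ hA hADt hlo hhi heI he'I (v + θ)

end Sizes

end Summit.HubbardSuperconductivity.HubbardSuperconductivity.Theorems.C4a

end
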